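import Summits.HodgeConjecture.HodgeConjecture.Theorems.F0P6aStubDOWNProvider
import HarnessLib

/-!
# `F0P6aStubDOWNSpecKey` — ★ RE-HOME of `Lines/F0_P6a_StubDOWN.lean`, PART 3 of 7 (size-lint split; cut at a declaration boundary).

Imports: ★ `Theorems.F0P6aStubDOWNProvider` = the previous part of the same Lines workfile `F0_P6a_StubDOWN` (size-lint split ×7) + `HarnessLib` (canonical header: bare `import` lines).
See PART 1 `Theorems/F0P6aStubDOWNLaws.lean` for the full re-home header and the original module docstring (verbatim there). Namespaces and sections KEPT
(re-opened below exactly as they stand at the cut, with their `open`∕`variable` lines replayed); code bytes = the workfile՚s, docstrings included; options preamble repeated from PART 1.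
HC_CM is proved only modulo the 7 printed citations (2 remaining: hLiu418 = stmt-HodgeConjecture-24832, h413 = stmt-HodgeConjecture-24833) until rung 0 closes; a re-home is count-neutral. -/

set_option autoImplicit false
set_option linter.dupNamespace false

noncomputable section

namespace Summit.HodgeConjecture.HodgeConjecture.Cruxes.HLiu418.F0P6aStubDOWN
open CategoryTheory CategoryTheory.Limits NumberField IsDedekindDomain MulAction
open scoped Matrix Polynomial Pointwise MonoidalCategory
open Literature.NumberTheory.GaloisRepresentations
open Literature.NumberTheory.Automorphic Literature.NumberTheory.Automorphic.UnitaryGroup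
open Literature.AlgebraicGeometry.ShimuraVarieties.UnitaryCanonicalModel
open Literature.NumberTheory.Automorphic.Liu2021.AppendixC
open Literature.AlgebraicGeometry.Motives (AlgPoints IntegralModel SchemeOver thickening thickeningGalAction thickeningLift specOver relFrobeniusOver frobeniusTwistOver)
open Literature.NumberTheory.DiophantineGeometry (geomResidueField specialFibreFunctor specResidueField)
open Literature.AlgebraicGeometry.RelativeSpec (ActionOver)
open Literature.NumberTheory.EllipticCurves (genericFibre)
open Literature.AlgebraicGeometry.GroupSchemes.AffineGroupScheme (Alg quotIncl)
open Summit.HodgeConjecture.HodgeConjecture.Cruxes.HLiu418.F0P6cDictConstructors (kerFI AdmSub IdealIsEtale isAdm_kerFI)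
open Summit.HodgeConjecture.HodgeConjecture.Cruxes.HLiu418.F0P6aModuliDatumDefs
open Summit.HodgeConjecture.HodgeConjecture.Cruxes.HLiu418.F0P6aRGDAssembly
open Summit.HodgeConjecture.HodgeConjecture.Cruxes.HLiu418.F0P6aDatumOfInputs
open Summit.HodgeConjecture.HodgeConjecture.Cruxes.HLiu418.F0P6aLineSpecialisation (spGeoOf canonicalLine_spGeoOf spGeoOf_surjective hrkG_of_dock
  exists_isogW₀_of_quotLeg mono_coverPin₀ le_ker_isogW₀_of_himg red₀Of_translΩ_eq_of_red₀Of_eq red₀Of_quotΩ_eq_red₀Of_translΩ_of_le_ker_layer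
  red₀Of_quotΩ_eq_of_quotLegReduction₀)  -- [ED. 4] organ heads BY NAME (incl. the §Q head `red₀Of_quotΩ_eq_of_quotLegReduction₀`, PART B)

section SpecAssembly
open AlgebraicGeometry
open Literature.AlgebraicGeometry.AbelianSchemes Literature.AlgebraicGeometry.AbelianSchemes.AbelianSchemeOver
open Summit.HodgeConjecture.HodgeConjecture.Cruxes.HLiu418.F0P6aLineSpecialisation (spGeoOf canonicalLine_spGeoOf spGeoOf_surjective)
open scoped MonObj CategoryTheory.Obj
variable {F : Type} [Field F] [NumberField F] [IsCMField F] {ι₁ : F →+* ℂ}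
    {Jstar : Matrix (Fin 2) (Fin 2) F}
    {K₀ : C5.OpenCompactSubgroup ↥(finAdelic ↥(maximalRealSubfield F) F (IsCMField.complexConj F) 2 Jstar)}
    {S : RecordSystemGS F Jstar ι₁ K₀} {hU7ₛ : S.HeckeTranslateDefinedOver}
    {hJ : (Jstar.map (IsCMField.complexConj F))ᵀ = Jstar} {hJu : IsUnit Jstar}
    {Fi : Type} [Field Fi] [Algebra F Fi] {Kc : C5.SmallLevel K₀} {G : Type} [Group G]
    {𝓜 : IntegralModel (𝓞 F) F ((thickening F Fi).obj (S.M.obj Kc))}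
    {w : HeightOneSpectrum (𝓞 F)} {hw : (IsCMField.complexConj F) • w ≠ w} {h𝓨 : (𝓜.localise w).IsSmoothProper 1}
    {θ : ActionOver (𝓜.localise w).total.hom ((Fi ≃ₐ[F] Fi) × G)}
    {e : Fi →ₐ[F] AlgebraicClosure (w.adicCompletion F)}


set_option maxHeartbeats 400000 in
/-- **(Σ-key) `stub_SPEC_keyOn` — THE KEY EXISTENTIAL AT A LIFTED POINT, `y₀`-CURRENCY** (split off `stub_SPEC_of_heads` for the ≤ 400 000 budget): for a lift `(y₀, L₀)` of
`(x̄, H)` (`red₀ y₀ = x̄`, `(red₀ y₀ = x̄) ▸ spGeoOf y₀ L₀ = H`) the values `q := red₀ (quotΩ y₀ L₀)` and `φ :=` the (ρ3-K) layer map of the (ρ1𝒞) leg satisfy HOM ∧ KILLS ∧ OFF ∧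
WD (= [WQ] for every lift) ∧ D6 (= the (IMG) row's backtracking line below `ker Γ(φ)` by (K3), the D6 head, (T-WD)).  After `subst` of the two equation binders no object is
transported. [cite: Liu2021, Prop. D.8 p. 135, pp. 136–138] [cite: Tate1997FiniteFlatGroupSchemes, (3.7)] [cite: SerreTate1968, §1 Lemma 2] -/
theorem stub_SPEC_keyOn (I : RGDInputsAt F ι₁ Jstar K₀ S hU7ₛ hJ hJu Fi Kc G 𝓜 w hw h𝓨 θ e) [ExpChar (geomResidueField w) I.pChar]
    [IsCommMonObj I.univ.X] -- (= `I.comm`; binder-position instance for the `serreTensor` tokens of the head texts; a `Prop`, so `haveI := I.comm` at fold)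
    (𝔡 : ∀ xbar, DockAt I xbar)
    (quotΩ : ∀ y, LineOf I y → AlgPoints (S.M.obj Kc) (AlgebraicClosure (w.adicCompletion F)))
    (translΩ : AlgPoints (S.M.obj Kc) (AlgebraicClosure (w.adicCompletion F)) → AlgPoints (S.M.obj Kc) (AlgebraicClosure (w.adicCompletion F)))
    (hhecke : HeckeClause I quotΩ translΩ) (hroof : RoofLink I quotΩ) (hroof₂ : RoofLink₂ I translΩ)
    (hunit : (UnitaryGroup.isUnit_placeForm Jstar hJu w).unit ∈ glInt 2 (w.adicCompletion F))
    (hKc : UnitaryGroup.IsHyperspecialAt ↥(maximalRealSubfield F) F (IsCMField.complexConj F) 2 Jstar Kc.1.1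
      (w.under (𝓞 ↥(maximalRealSubfield F))))
    {m : ℕ} (E' : Matrix (Fin m) (Fin m) (𝓞 F)) (hE' : E' * E' = E') (P : Matrix (Fin m) (Fin 1) (𝓞 F)) (Q : Matrix (Fin 1) (Fin m) (𝓞 F))
    (hP : E' * P = P) (hQ : Q * E' = Q) (hQP : Q * P = Matrix.scalar (Fin 1) (I.pChar : 𝓞 F))
    (hPQ : P * Q = Matrix.scalar (Fin m) (I.pChar : 𝓞 F) * E') (h𝔭 : Ideal.span (Set.range fun k => P k 0) = w.asIdeal)
    -- ═════ (ρ1𝒞) HEAD `exists_quotLegReduction` v3-to-be (LA1-p01 (g3) v2 dd38f771 :303 binders VERBATIM; rows := [WQ] `hdat` rows VERBATIM ((FLAT-SURJ)(ACT)(LVL)(SIM)(K2-gen)(RK)(KILL)(DOCK),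
    --        DOCK parenthesised) ∧ (IMG) SHAPE (a) LAST — LA2-plan (g2) 09:18:21Z (2) (Q-IMG) YES).  Fed at fold by `exists_quotLegReduction I`.
    (hρ1 : ∀ (𝔡 : ∀ xbar, DockAt I xbar)
      -- SOCKET ORDER OF RECORD (LA2-plan (g2) 09:29:54Z (1)): `𝔡 quotΩ translΩ hhecke hroof hroof₂ hunit hKc`, THEN the Serre letters, THEN `(y) (L)`; no `hunr`∕`hpN` head binders
      (quotΩ : ∀ y, LineOf I y → AlgPoints (S.M.obj Kc) (AlgebraicClosure (w.adicCompletion F)))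
      (translΩ : AlgPoints (S.M.obj Kc) (AlgebraicClosure (w.adicCompletion F)) → AlgPoints (S.M.obj Kc) (AlgebraicClosure (w.adicCompletion F)))
      (hhecke : HeckeClause I quotΩ translΩ) (hroof : RoofLink I quotΩ) (hroof₂ : RoofLink₂ I translΩ)
      (hunit : (UnitaryGroup.isUnit_placeForm Jstar hJu w).unit ∈ glInt 2 (w.adicCompletion F))
      (hKc : UnitaryGroup.IsHyperspecialAt ↥(maximalRealSubfield F) F (IsCMField.complexConj F) 2 Jstar Kc.1.1
        (w.under (𝓞 ↥(maximalRealSubfield F))))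
      {m : ℕ} (E' : Matrix (Fin m) (Fin m) (𝓞 F)) (hE' : E' * E' = E') (P : Matrix (Fin m) (Fin 1) (𝓞 F)) (Q : Matrix (Fin 1) (Fin m) (𝓞 F))
      (hP : E' * P = P) (hQ : Q * E' = Q) (hQP : Q * P = Matrix.scalar (Fin 1) (I.pChar : 𝓞 F))
      (hPQ : P * Q = Matrix.scalar (Fin m) (I.pChar : 𝓞 F) * E') (h𝔭 : Ideal.span (Set.range fun k => P k 0) = w.asIdeal)
      (y : AlgPoints (S.M.obj Kc) (AlgebraicClosure (w.adicCompletion F))) (L : LineOf I y),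
      haveI := I.comm
      letI := (𝔡 (red₀Of S Kc 𝓜 w h𝓨 e y)).grp₀
      haveI := (𝔡 (red₀Of S Kc 𝓜 w h𝓨 e y)).aff₀
        ∃ (ψ : (sch₀Of 𝓜 w I.univ (red₀Of S Kc 𝓜 w h𝓨 e y)).X ⟶ (sch₀Of 𝓜 w (serreTensor I.act E' hE') (red₀Of S Kc 𝓜 w h𝓨 e (quotΩ y L))).X) (_ : IsMonHom ψ),
          -- (FLAT-SURJ)
          (Flat ψ.left ∧ Function.Surjective ψ.left.base) ∧
          -- (ACT) `𝒪_F`-equivariance, `act₀Of` currency on both sides (`serreAction` on `𝒞`)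
          (∀ a : 𝓞 F, (act₀Of 𝓜 w I.univ I.act a (red₀Of S Kc 𝓜 w h𝓨 e y)).hom.hom.hom ≫ ψ =
            ψ ≫ (act₀Of 𝓜 w (serreTensor I.act E' hE') (serreAction I.act E' hE') a (red₀Of S Kc 𝓜 w h𝓨 e (quotΩ y L))).hom.hom.hom) ∧
          -- (LVL) level points: `ψ(σᵃ(x̄)) = (σᵃ ≫ ψ_P)(x̄″)`
          (∀ a : Fin I.g ⊕ Fin I.g → ZMod I.N,
            AlgPoints.map ψ (lvlPt₀Of 𝓜 w I.univ I.lvl (red₀Of S Kc 𝓜 w h𝓨 e y) a) =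
              ((serreTensor I.act E' hE').baseChange (pullback.fst (𝓜.localise w).total.hom (specResidueField w))).restrictPt (red₀Of S Kc 𝓜 w h𝓨 e (quotΩ y L)).left
                ((serreTensor I.act E' hE').sectionBaseChange (pullback.fst (𝓜.localise w).total.hom (specResidueField w)) (I.lvl.section_ a ≫ serreTranslate I.act E' hE' P))) ∧
          -- (SIM) for EVERY downstairs dual pair of `𝒞_{x̄″}` through which the cover leg pulls back to `λ ≫ [p]`: `ψ^* λ_B̄ = λ_{x̄} ≫ [p]`
          (∀ (DBs : (sch₀Of 𝓜 w (serreTensor I.act E' hE') (red₀Of S Kc 𝓜 w h𝓨 e (quotΩ y L))).DualPair)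
            (_ : Nonempty ((Scheme.Modules.pullback (DualPair.unitHatSlice DBs)).obj DBs.P ≅ SheafOfModules.unit _))
            (lamBs : (sch₀Of 𝓜 w (serreTensor I.act E' hE') (red₀Of S Kc 𝓜 w h𝓨 e (quotΩ y L))).X ⟶ DBs.hat.X) [IsMonHom lamBs],
            (haveI := isMonHom_coverLeg (pullback.fst (𝓜.localise w).total.hom (specResidueField w)) (red₀Of S Kc 𝓜 w h𝓨 e (quotΩ y L)).left I.act E' hE' P
             baseChangeHom (baseChangeHom (serreTranslate I.act E' hE' P) (pullback.fst (𝓜.localise w).total.hom (specResidueField w))) (red₀Of S Kc 𝓜 w h𝓨 e (quotΩ y L)).left ≫ lamBs ≫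
                DualPair.dualIsogenyOver (baseChangeHom (baseChangeHom (serreTranslate I.act E' hE' P) (pullback.fst (𝓜.localise w).total.hom (specResidueField w))) (red₀Of S Kc 𝓜 w h𝓨 e (quotΩ y L)).left)
                  (dual₀Of 𝓜 w I.univ I.dual (red₀Of S Kc 𝓜 w h𝓨 e (quotΩ y L))) DBs =
              (pol₀Of 𝓜 w I.univ I.pol (red₀Of S Kc 𝓜 w h𝓨 e (quotΩ y L))).lam ≫ (dual₀Of 𝓜 w I.univ I.dual (red₀Of S Kc 𝓜 w h𝓨 e (quotΩ y L))).hat.mulN I.pChar) →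
            ψ ≫ lamBs ≫ DualPair.dualIsogenyOver ψ (dual₀Of 𝓜 w I.univ I.dual (red₀Of S Kc 𝓜 w h𝓨 e y)) DBs =
              (pol₀Of 𝓜 w I.univ I.pol (red₀Of S Kc 𝓜 w h𝓨 e y)).lam ≫ (dual₀Of 𝓜 w I.univ I.dual (red₀Of S Kc 𝓜 w h𝓨 e y)).hat.mulN I.pChar) ∧
          -- (K2-gen) every ideal bound on the kernel descends: `Ker q(Ω̄) ⊆ A_y[𝔞](Ω̄)` for the upstairs leg is recorded through `L`'s roof, so downstairs:
          (∀ 𝔞 : Ideal (𝓞 F), (∀ Pt ∈ L.1, IsIdealTorsionΩ S Kc 𝓜 w e I.univ I.act y 𝔞 Pt) →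
            (∀ Pt : (fibreΩOf S Kc 𝓜 w e I.univ y).Points (AlgebraicClosure (w.adicCompletion F)),
              (∀ r ∈ w.asIdeal * ((IsCMField.complexConj F) • w).asIdeal, (AlgPoints.map (actΩOf S Kc 𝓜 w e I.univ I.act r y).hom.hom.hom Pt :
                (fibreΩOf S Kc 𝓜 w e I.univ y).Points (AlgebraicClosure (w.adicCompletion F))) = 1) → IsIdealTorsionΩ S Kc 𝓜 w e I.univ I.act y 𝔞 Pt) →
            ∀ ⦃T : SchemeOver (geomResidueField w)⦄ (z : T ⟶ (sch₀Of 𝓜 w I.univ (red₀Of S Kc 𝓜 w h𝓨 e y)).X),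
              z ≫ ψ = 1 → ∀ r ∈ 𝔞, z ≫ (act₀Of 𝓜 w I.univ I.act r (red₀Of S Kc 𝓜 w h𝓨 e y)).hom.hom.hom = 1) ∧
          -- (RK) the rank of `Ker ψ`, BY VALUE for every closed realisation (LA2-p04 (g2) (C6′) `hrkᵢ` text)
          (∀ (K : SchemeOver (geomResidueField w)) [GrpObj K] [IsAffine K.left] [Module.Finite (geomResidueField w) (Alg K)]
            (κ : K ⟶ (sch₀Of 𝓜 w I.univ (red₀Of S Kc 𝓜 w h𝓨 e y)).X) [IsMonHom κ] [IsClosedImmersion κ.left],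
            (∀ ⦃T : SchemeOver (geomResidueField w)⦄ (t : T ⟶ (sch₀Of 𝓜 w I.univ (red₀Of S Kc 𝓜 w h𝓨 e y)).X), (∃ s : T ⟶ K, s ≫ κ = t) ↔ t ≫ ψ = 1) →
            Module.finrank (geomResidueField w) (Alg K) = I.pChar ^ I.fDeg * I.pChar ^ I.fDeg) ∧
          -- (KILL) `ψ` kills `V(spGeoOf y L) ↪ G₀(x̄) ↪ A_{x̄}`
          quotIncl (𝔡 (red₀Of S Kc 𝓜 w h𝓨 e y)).G₀ (spGeoOf I 𝔡 y L).1 ≫ (𝔡 (red₀Of S Kc 𝓜 w h𝓨 e y)).ι₀G ≫ ψ = 1 ∧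
          -- (DOCK) `Ker ψ ∩ G₀(x̄) = V(spGeoOf y L)` on all `T`-points of the dock
          (∀ ⦃T : SchemeOver (geomResidueField w)⦄ (t : T ⟶ (𝔡 (red₀Of S Kc 𝓜 w h𝓨 e y)).G₀),
            t ≫ (𝔡 (red₀Of S Kc 𝓜 w h𝓨 e y)).ι₀G ≫ ψ = 1 ↔
              ∃ s : T ⟶ specOver (geomResidueField w) (Alg (𝔡 (red₀Of S Kc 𝓜 w h𝓨 e y)).G₀ ⧸ (spGeoOf I 𝔡 y L).1),
                s ≫ quotIncl (𝔡 (red₀Of S Kc 𝓜 w h𝓨 e y)).G₀ (spGeoOf I 𝔡 y L).1 = t) ∧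
          -- (IMG) row, SHAPE (a) of record (LA2-plan (g2) 09:18:21Z (2)): the BACKTRACKING line `L_b` with `himg` (LA2-p03 (g3) f3424bb3 :279–:285 text at `H″ := spGeoOf I 𝔡 (quotΩ y L) L_b`)
          ∃ Lb : LineOf I (quotΩ y L), quotΩ (quotΩ y L) Lb = translΩ y ∧
            (letI := (𝔡 (red₀Of S Kc 𝓜 w h𝓨 e (quotΩ y L))).grp₀; haveI := (𝔡 (red₀Of S Kc 𝓜 w h𝓨 e (quotΩ y L))).aff₀;
              ∀ ⦃T : SchemeOver (geomResidueField w)⦄ (t : T ⟶ (𝔡 (red₀Of S Kc 𝓜 w h𝓨 e y)).G₀),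
                ∃ s : T ⟶ specOver (geomResidueField w) (Alg (𝔡 (red₀Of S Kc 𝓜 w h𝓨 e (quotΩ y L))).G₀ ⧸ (spGeoOf I 𝔡 (quotΩ y L) Lb).1),
                  s ≫ quotIncl (𝔡 (red₀Of S Kc 𝓜 w h𝓨 e (quotΩ y L))).G₀ (spGeoOf I 𝔡 (quotΩ y L) Lb).1 ≫ (𝔡 (red₀Of S Kc 𝓜 w h𝓨 e (quotΩ y L))).ι₀G ≫
                      baseChangeHom (baseChangeHom (serreTranslate I.act E' hE' P) (pullback.fst (𝓜.localise w).total.hom (specResidueField w))) (red₀Of S Kc 𝓜 w h𝓨 e (quotΩ y L)).left =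
                    t ≫ (𝔡 (red₀Of S Kc 𝓜 w h𝓨 e y)).ι₀G ≫ ψ))
    -- ═════ (ρ3-K) HEAD `exists_isogW₀_of_quotLeg` (LA2-p03 (g3) f3424bb3 :171 VERBATIM: general `(xbar xbar″ ψ)` currency; (LAYER) ∧ HOM ∧ EQUIV ∧ (KER) ∧ UNIQ).  Fed at fold by `exists_isogW₀_of_quotLeg I`.
    (hK1 : ∀ {m : ℕ} (E' : Matrix (Fin m) (Fin m) (𝓞 F)) (hE' : E' * E' = E') (P : Matrix (Fin m) (Fin 1) (𝓞 F)) (Q : Matrix (Fin 1) (Fin m) (𝓞 F))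
      (hP : E' * P = P) (hQ : Q * E' = Q) (hQP : Q * P = Matrix.scalar (Fin 1) (I.pChar : 𝓞 F))
      (hPQ : P * Q = Matrix.scalar (Fin m) (I.pChar : 𝓞 F) * E') (h𝔭 : Ideal.span (Set.range fun k => P k 0) = w.asIdeal)
      (𝔡 : ∀ xbar, DockAt I xbar) (xbar xbar'' : AlgPoints (𝓜.localise w).reductionAt (geomResidueField w))
      (ψ : (sch₀Of 𝓜 w I.univ xbar).X ⟶ (sch₀Of 𝓜 w (serreTensor I.act E' hE') xbar'').X) [IsMonHom ψ]
      (hact : ∀ a : 𝓞 F, (act₀Of 𝓜 w I.univ I.act a xbar).hom.hom.hom ≫ ψ =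
        ψ ≫ (act₀Of 𝓜 w (serreTensor I.act E' hE') (serreAction I.act E' hE') a xbar'').hom.hom.hom),
      letI := (𝔡 xbar).grp₀; letI := (𝔡 xbar'').grp₀
      ∃ φ : (𝔡 xbar).G₀ ⟶ (𝔡 xbar'').G₀,
        -- (LAYER) the square through the cover pin — ★ (ρ3a)՚s `hover` with `ι₂ := (𝔡 x̄″).ι₀G ≫ c̄_{x̄″}`, `ι₁ := (𝔡 x̄).ι₀G`
        φ ≫ (𝔡 xbar'').ι₀G ≫
            baseChangeHom (baseChangeHom (serreTranslate I.act E' hE' P) (pullback.fst (𝓜.localise w).total.hom (specResidueField w))) xbar''.left =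
          (𝔡 xbar).ι₀G ≫ ψ ∧
        -- `IsogHomLaw` letter
        IsMonHom φ ∧
        -- `𝒪_F`-equivariance on the docks
        (∀ a : 𝓞 F, (𝔡 xbar).β₀ a ≫ φ = φ ≫ (𝔡 xbar'').β₀ a) ∧
        -- (KER) the kernel of `φ` on all `T`-points is the kernel of `ι₀G ≫ ψ`
        (∀ ⦃T : SchemeOver (geomResidueField w)⦄ (j : T ⟶ (𝔡 xbar).G₀), j ≫ φ = 1 ↔ j ≫ (𝔡 xbar).ι₀G ≫ ψ = 1) ∧
        -- UNIQUENESS over (LAYER)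
        ∀ φ' : (𝔡 xbar).G₀ ⟶ (𝔡 xbar'').G₀,
          φ' ≫ (𝔡 xbar'').ι₀G ≫
              baseChangeHom (baseChangeHom (serreTranslate I.act E' hE' P) (pullback.fst (𝓜.localise w).total.hom (specResidueField w))) xbar''.left =
            (𝔡 xbar).ι₀G ≫ ψ → φ' = φ)
    -- ═════ (ρ3-K) `mono_coverPin₀` (LA2-p03 (g3) f3424bb3 :131 VERBATIM: the cover pin `ι₀G(x̄″) ≫ c̄_{x̄″}` is a monomorphism).  Fed at fold by `mono_coverPin₀ I`.
    (hMono : ∀ {m : ℕ} (E' : Matrix (Fin m) (Fin m) (𝓞 F)) (hE' : E' * E' = E') (P : Matrix (Fin m) (Fin 1) (𝓞 F)) (Q : Matrix (Fin 1) (Fin m) (𝓞 F))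
      (hP : E' * P = P) (hQ : Q * E' = Q) (hQP : Q * P = Matrix.scalar (Fin 1) (I.pChar : 𝓞 F))
      (hPQ : P * Q = Matrix.scalar (Fin m) (I.pChar : 𝓞 F) * E') (h𝔭 : Ideal.span (Set.range fun k => P k 0) = w.asIdeal)
      (𝔡 : ∀ xbar, DockAt I xbar) (xbar'' : AlgPoints (𝓜.localise w).reductionAt (geomResidueField w)),
      Mono ((𝔡 xbar'').ι₀G ≫
          baseChangeHom (baseChangeHom (serreTranslate I.act E' hE' P) (pullback.fst (𝓜.localise w).total.hom (specResidueField w))) xbar''.left :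
        (𝔡 xbar'').G₀ ⟶ (sch₀Of 𝓜 w (serreTensor I.act E' hE') xbar'').X))
    -- ═════ (ρ3-K) (K3) `le_ker_isogW₀_of_himg` (LA2-p03 (g3) f3424bb3 :270 VERBATIM: the (IMG) row puts `H″` below `ker Γ(φ)`).  Fed at fold by `le_ker_isogW₀_of_himg I`.
    (hK3 : ∀ {m : ℕ} (E' : Matrix (Fin m) (Fin m) (𝓞 F)) (hE' : E' * E' = E') (P : Matrix (Fin m) (Fin 1) (𝓞 F)) (Q : Matrix (Fin 1) (Fin m) (𝓞 F))
      (hP : E' * P = P) (hQ : Q * E' = Q) (hQP : Q * P = Matrix.scalar (Fin 1) (I.pChar : 𝓞 F))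
      (hPQ : P * Q = Matrix.scalar (Fin m) (I.pChar : 𝓞 F) * E') (h𝔭 : Ideal.span (Set.range fun k => P k 0) = w.asIdeal)
      (𝔡 : ∀ xbar, DockAt I xbar) (xbar xbar'' : AlgPoints (𝓜.localise w).reductionAt (geomResidueField w))
      (ψ : (sch₀Of 𝓜 w I.univ xbar).X ⟶ (sch₀Of 𝓜 w (serreTensor I.act E' hE') xbar'').X)
      (φ : (𝔡 xbar).G₀ ⟶ (𝔡 xbar'').G₀)
      (hlayer : φ ≫ (𝔡 xbar'').ι₀G ≫
          baseChangeHom (baseChangeHom (serreTranslate I.act E' hE' P) (pullback.fst (𝓜.localise w).total.hom (specResidueField w))) xbar''.left =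
        (𝔡 xbar).ι₀G ≫ ψ)
      (H'' : SubOf I 𝔡 xbar'')
      (himg : letI := (𝔡 xbar'').grp₀; haveI := (𝔡 xbar'').aff₀;
        ∀ ⦃T : SchemeOver (geomResidueField w)⦄ (t : T ⟶ (𝔡 xbar).G₀),
          ∃ s : T ⟶ specOver (geomResidueField w) (Alg (𝔡 xbar'').G₀ ⧸ H''.1),
            s ≫ quotIncl (𝔡 xbar'').G₀ H''.1 ≫ (𝔡 xbar'').ι₀G ≫
                baseChangeHom (baseChangeHom (serreTranslate I.act E' hE' P) (pullback.fst (𝓜.localise w).total.hom (specResidueField w))) xbar''.left =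
              t ≫ (𝔡 xbar).ι₀G ≫ ψ),
      letI := (𝔡 xbar'').grp₀; haveI := (𝔡 xbar'').aff₀;
      (∃ s : (𝔡 xbar).G₀ ⟶ specOver (geomResidueField w) (Alg (𝔡 xbar'').G₀ ⧸ H''.1), s ≫ quotIncl (𝔡 xbar'').G₀ H''.1 = φ) ∧
        H''.1 ≤ (RingHom.ker φ.left.appTop.hom : Ideal (Alg (𝔡 xbar'').G₀)))
    -- ═════ (T-WD) HEAD `red₀Of_translΩ_eq_of_red₀Of_eq` (LA6-p01 (g2) 70de5998 :305 VERBATIM).  Fed at fold by `red₀Of_translΩ_eq_of_red₀Of_eq I`.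
    (hTWD : ∀ (translΩ : AlgPoints (S.M.obj Kc) (AlgebraicClosure (w.adicCompletion F)) → AlgPoints (S.M.obj Kc) (AlgebraicClosure (w.adicCompletion F)))
      (hroof₂ : RoofLink₂ I translΩ) (hpN : Nat.Coprime I.pChar I.N)
      {y₁ y₂ : AlgPoints (S.M.obj Kc) (AlgebraicClosure (w.adicCompletion F))} (h : red₀Of S Kc 𝓜 w h𝓨 e y₁ = red₀Of S Kc 𝓜 w h𝓨 e y₂),
      red₀Of S Kc 𝓜 w h𝓨 e (translΩ y₁) = red₀Of S Kc 𝓜 w h𝓨 e (translΩ y₂))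
    -- ═════ D6 DOWNSTAIRS HEAD `red₀Of_quotΩ_eq_red₀Of_translΩ_of_le_ker_layer` (LA6-p01 (g3) 2673ec94 :145 VERBATIM, two-lift form, eats `Lb hLb hbt`).  Fed at fold by `red₀Of_quotΩ_eq_red₀Of_translΩ_of_le_ker_layer I`.
    (hD6 : ∀ {m : ℕ} (E' : Matrix (Fin m) (Fin m) (𝓞 F)) (hE' : E' * E' = E') (P : Matrix (Fin m) (Fin 1) (𝓞 F))
      (𝔡 : ∀ xbar, DockAt I xbar)
      (quotΩ : ∀ y, LineOf I y → AlgPoints (S.M.obj Kc) (AlgebraicClosure (w.adicCompletion F)))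
      (translΩ : AlgPoints (S.M.obj Kc) (AlgebraicClosure (w.adicCompletion F)) → AlgPoints (S.M.obj Kc) (AlgebraicClosure (w.adicCompletion F)))
      -- [WQ] two-lift form for `sp := spGeoOf I 𝔡` (the (C6α) fold `red₀Of_quotΩ_eq_of_quotLegReduction₀` with its data fixed)
      (hWQ : ∀ (y y' : AlgPoints (S.M.obj Kc) (AlgebraicClosure (w.adicCompletion F))) (L : LineOf I y) (L' : LineOf I y')
        (h : red₀Of S Kc 𝓜 w h𝓨 e y = red₀Of S Kc 𝓜 w h𝓨 e y'),
        h ▸ spGeoOf I 𝔡 y L = spGeoOf I 𝔡 y' L' → red₀Of S Kc 𝓜 w h𝓨 e (quotΩ y L) = red₀Of S Kc 𝓜 w h𝓨 e (quotΩ y' L'))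
      (y : AlgPoints (S.M.obj Kc) (AlgebraicClosure (w.adicCompletion F))) (L : LineOf I y)
      -- the reduced `𝒞`-leg at `(y, L)` ((ρ1𝒞)) with its (DOCK) row VERBATIM
      (ψ : haveI := I.comm
        (sch₀Of 𝓜 w I.univ (red₀Of S Kc 𝓜 w h𝓨 e y)).X ⟶ (sch₀Of 𝓜 w (serreTensor I.act E' hE') (red₀Of S Kc 𝓜 w h𝓨 e (quotΩ y L))).X)
      (hdock : letI := (𝔡 (red₀Of S Kc 𝓜 w h𝓨 e y)).grp₀; haveI := (𝔡 (red₀Of S Kc 𝓜 w h𝓨 e y)).aff₀;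
        ∀ ⦃T : SchemeOver (geomResidueField w)⦄ (t : T ⟶ (𝔡 (red₀Of S Kc 𝓜 w h𝓨 e y)).G₀),
          t ≫ (𝔡 (red₀Of S Kc 𝓜 w h𝓨 e y)).ι₀G ≫ ψ = 1 ↔
            ∃ s : T ⟶ specOver (geomResidueField w) (Alg (𝔡 (red₀Of S Kc 𝓜 w h𝓨 e y)).G₀ ⧸ (spGeoOf I 𝔡 y L).1),
              s ≫ quotIncl (𝔡 (red₀Of S Kc 𝓜 w h𝓨 e y)).G₀ (spGeoOf I 𝔡 y L).1 = t)
      -- the layer map OVER `ψ` THROUGH THE COVER PIN ((ρ3-K)), a homomorphism; the pin a monomorphism (`mono_coverPin₀`)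
      (φ : (𝔡 (red₀Of S Kc 𝓜 w h𝓨 e y)).G₀ ⟶ (𝔡 (red₀Of S Kc 𝓜 w h𝓨 e (quotΩ y L))).G₀)
      (hφ : letI := (𝔡 (red₀Of S Kc 𝓜 w h𝓨 e y)).grp₀; letI := (𝔡 (red₀Of S Kc 𝓜 w h𝓨 e (quotΩ y L))).grp₀; IsMonHom φ)
      (hpin : haveI := I.comm
        Mono ((𝔡 (red₀Of S Kc 𝓜 w h𝓨 e (quotΩ y L))).ι₀G ≫
          baseChangeHom (baseChangeHom (serreTranslate I.act E' hE' P) (pullback.fst (𝓜.localise w).total.hom (specResidueField w))) (red₀Of S Kc 𝓜 w h𝓨 e (quotΩ y L)).left))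
      (hover : haveI := I.comm
        φ ≫ (𝔡 (red₀Of S Kc 𝓜 w h𝓨 e (quotΩ y L))).ι₀G ≫
            baseChangeHom (baseChangeHom (serreTranslate I.act E' hE' P) (pullback.fst (𝓜.localise w).total.hom (specResidueField w))) (red₀Of S Kc 𝓜 w h𝓨 e (quotΩ y L)).left =
          (𝔡 (red₀Of S Kc 𝓜 w h𝓨 e y)).ι₀G ≫ ψ)
      -- the NAMED backtracking line: below the kernel ((IMG) + (ρ3-K)) and Hecke-backtracking ((H4′)∕★ HBT)
      (Lb : LineOf I (quotΩ y L))
      (hLb : letI := (𝔡 (red₀Of S Kc 𝓜 w h𝓨 e (quotΩ y L))).grp₀; haveI := (𝔡 (red₀Of S Kc 𝓜 w h𝓨 e (quotΩ y L))).aff₀;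
        (spGeoOf I 𝔡 (quotΩ y L) Lb).1 ≤ (RingHom.ker φ.left.appTop.hom : Ideal (Alg (𝔡 (red₀Of S Kc 𝓜 w h𝓨 e (quotΩ y L))).G₀)))
      (hbt : quotΩ (quotΩ y L) Lb = translΩ y)
      -- D6's hypothesis letter and a second lift of `(x̄″, H′)`
      (H' : SubOf I 𝔡 (red₀Of S Kc 𝓜 w h𝓨 e (quotΩ y L)))
      (hle : letI := (𝔡 (red₀Of S Kc 𝓜 w h𝓨 e (quotΩ y L))).grp₀; haveI := (𝔡 (red₀Of S Kc 𝓜 w h𝓨 e (quotΩ y L))).aff₀;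
        H'.1 ≤ (RingHom.ker φ.left.appTop.hom : Ideal (Alg (𝔡 (red₀Of S Kc 𝓜 w h𝓨 e (quotΩ y L))).G₀)))
      (y₂ : AlgPoints (S.M.obj Kc) (AlgebraicClosure (w.adicCompletion F))) (L₂ : LineOf I y₂)
      (h₂ : red₀Of S Kc 𝓜 w h𝓨 e y₂ = red₀Of S Kc 𝓜 w h𝓨 e (quotΩ y L)) (hsp₂ : h₂ ▸ spGeoOf I 𝔡 y₂ L₂ = H'),
      red₀Of S Kc 𝓜 w h𝓨 e (quotΩ y₂ L₂) = red₀Of S Kc 𝓜 w h𝓨 e (translΩ y))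
    -- [WQ] in its two-lift form for `sp := spGeoOf I 𝔡` (the main theorem feeds `hWQ` with `hdat :=` the (ρ1𝒞) rows minus (IMG))
    (hWQ' : ∀ (y y' : AlgPoints (S.M.obj Kc) (AlgebraicClosure (w.adicCompletion F))) (L : LineOf I y) (L' : LineOf I y')
      (h : red₀Of S Kc 𝓜 w h𝓨 e y = red₀Of S Kc 𝓜 w h𝓨 e y') (hsp : h ▸ spGeoOf I 𝔡 y L = spGeoOf I 𝔡 y' L'),
      red₀Of S Kc 𝓜 w h𝓨 e (quotΩ y L) = red₀Of S Kc 𝓜 w h𝓨 e (quotΩ y' L'))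
    (y₀ : AlgPoints (S.M.obj Kc) (AlgebraicClosure (w.adicCompletion F))) (L₀ : LineOf I y₀) (x : AlgPoints (𝓜.localise w).reductionAt (geomResidueField w)) (hx : red₀Of S Kc 𝓜 w h𝓨 e y₀ = x)
    (H : SubOf I 𝔡 x) (hH : hx ▸ spGeoOf I 𝔡 y₀ L₀ = H) :
    ∃ (q : AlgPoints (𝓜.localise w).reductionAt (geomResidueField w)) (φ : (𝔡 x).G₀ ⟶ (𝔡 q).G₀),
      (letI := (𝔡 x).grp₀; letI := (𝔡 q).grp₀; IsMonHom φ) ∧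
      (letI := (𝔡 x).grp₀; haveI := (𝔡 x).aff₀; letI := (𝔡 q).grp₀; quotIncl (𝔡 x).G₀ H.1 ≫ φ = 1) ∧
      ((¬ ∃ y, red₀Of S Kc 𝓜 w h𝓨 e y = x) → q = x) ∧
      (∀ (y : AlgPoints (S.M.obj Kc) (AlgebraicClosure (w.adicCompletion F))) (L : LineOf I y) (hx' : red₀Of S Kc 𝓜 w h𝓨 e y = x), hx' ▸ spGeoOf I 𝔡 y L = H → q = red₀Of S Kc 𝓜 w h𝓨 e (quotΩ y L)) ∧
      (∀ H' : SubOf I 𝔡 q,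
        (letI := (𝔡 q).grp₀; haveI := (𝔡 q).aff₀; H'.1 ≤ (RingHom.ker φ.left.appTop.hom : Ideal (Alg (𝔡 q).G₀))) →
        ∀ y₃ : AlgPoints (S.M.obj Kc) (AlgebraicClosure (w.adicCompletion F)), red₀Of S Kc 𝓜 w h𝓨 e y₃ = x →
          ∀ (y₂ : AlgPoints (S.M.obj Kc) (AlgebraicClosure (w.adicCompletion F))) (L₂ : LineOf I y₂) (hx₂ : red₀Of S Kc 𝓜 w h𝓨 e y₂ = q), hx₂ ▸ spGeoOf I 𝔡 y₂ L₂ = H' →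
            red₀Of S Kc 𝓜 w h𝓨 e (quotΩ y₂ L₂) = red₀Of S Kc 𝓜 w h𝓨 e (translΩ y₃)) := by
  -- ONE term for `IsCommMonObj I.univ.X` (head-room cure, «M-151» (6) row №2, LA2-p02 (g8) 2026-09-03): the binder instance and `I.comm` (`haveI := I.comm` in the `hρ1` ∕ `hD6`
  -- binders) are defeq by proof irrelevance but not syntactically equal; `subst` makes every cross-family unification below syntactic (357 811 → 190 622 heartbeats; → 122 582 with the (DOCK) reading of KILLS below).
  have hci : I.comm = ‹IsCommMonObj I.univ.X› := rfl
  subst hci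
  haveI : IsCommMonObj I.univ.X := I.comm
  haveI hpChar : Fact I.pChar.Prime := ⟨I.hpChar.1⟩
  have hpN_of : AlgPoints (S.M.obj Kc) (AlgebraicClosure (w.adicCompletion F)) → Nat.Coprime I.pChar I.N := fun y =>
    haveI := I.charP₀
    I.lvl.coprime_of_charP (spPt 𝓜 w (red₀Of S Kc 𝓜 w h𝓨 e y)) I.relDim (by rw [I.hg]; exact Module.finrank_pos) I.pChar
  subst hx
  have hH' : spGeoOf I 𝔡 y₀ L₀ = H := hH
  subst hH'
  -- the (ρ1𝒞) leg `ψ` at `(y₀, L₀)` with its rows, and its (ρ3-K) layer map `φ` (eliminators, not `cases`: the goal is large)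
  refine (hρ1 𝔡 quotΩ translΩ hhecke hroof hroof₂ hunit hKc E' hE' P Q hP hQ hQP hPQ h𝔭 y₀ L₀).elim fun ψ hψ => hψ.elim fun hm hrows => ?_
  haveI := hm
  refine (hK1 E' hE' P Q hP hQ hQP hPQ h𝔭 𝔡 (red₀Of S Kc 𝓜 w h𝓨 e y₀) (red₀Of S Kc 𝓜 w h𝓨 e (quotΩ y₀ L₀)) ψ hrows.2.1).elim fun φ hφ => ?_
  -- KILLS is read off the (DOCK) row (`⟨𝟙, id_comp⟩`), not the (KILL) row: (DOCK) and (KER) both bind `⦃T : SchemeOver (geomResidueField w)⦄`, so their two sides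
  -- carry the same `CommRing (geomResidueField w)` instance term and meet syntactically; (KILL)՚s `quotIncl …`-typed side carries `Field.toCommRing ∘ instField`
  -- instead and cost 66 k heartbeats to unify with (KER) (LA2-p02 (g8) diff probe; 190 622 → 122 582).
  refine ⟨red₀Of S Kc 𝓜 w h𝓨 e (quotΩ y₀ L₀), φ, hφ.2.1, (hφ.2.2.2.1 _).2 ((hrows.2.2.2.2.2.2.2.1 _).2 ⟨𝟙 _, Category.id_comp _⟩),
    fun h => (h ⟨y₀, rfl⟩).elim, ?_, ?_⟩
  · intro y L hx' hH'
    exact (hWQ' y y₀ L L₀ hx' hH').symm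
  · -- D6: the (IMG) row names the backtracking line `L_b`; (K3) puts it below `ker Γ(φ)`; the D6 head + (T-WD) conclude
    intro H' hle y₃ hy₃ y₂ L₂ hx₂ hH₂
    refine hrows.2.2.2.2.2.2.2.2.elim fun Lb hLb => ?_
    have himg₀ := hLb.2 -- (elaborate the (IMG) projection WITHOUT expected type, then apply: lesson 15)
    have hK3' := hK3 E' hE' P Q hP hQ hQP hPQ h𝔭 𝔡 (red₀Of S Kc 𝓜 w h𝓨 e y₀) (red₀Of S Kc 𝓜 w h𝓨 e (quotΩ y₀ L₀)) ψ φ hφ.1 (spGeoOf I 𝔡 (quotΩ y₀ L₀) Lb) himg₀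
    have h2 : red₀Of S Kc 𝓜 w h𝓨 e (quotΩ y₂ L₂) = red₀Of S Kc 𝓜 w h𝓨 e (translΩ y₀) :=
      hD6 E' hE' P 𝔡 quotΩ translΩ (fun y y' L L' h hsp => hWQ' y y' L L' h hsp) y₀ L₀ ψ hrows.2.2.2.2.2.2.2.1 φ hφ.2.1
        (hMono E' hE' P Q hP hQ hQP hPQ h𝔭 𝔡 (red₀Of S Kc 𝓜 w h𝓨 e (quotΩ y₀ L₀))) hφ.1 Lb hK3'.2 hLb.1 H' hle y₂ L₂ hx₂ hH₂
    exact h2.trans (hTWD translΩ hroof₂ (hpN_of y₀) hy₃.symm)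
  -- ── KEY at every `(x̄, H)`: ON the sheet by `key_on` at a lift, OFF the sheet the trivial values

end SpecAssembly
end Summit.HodgeConjecture.HodgeConjecture.Cruxes.HLiu418.F0P6aStubDOWN
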